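import Summits.Ventures.CertifiedManyBodySolver.Observables.StructureFactorsPositivity
import Summits.Ventures.CertifiedManyBodySolver.Observables.StructureFactorsSumRules

/-!
# M3 observables (iii), the LRO ceiling: `|f̂(q)|² · S(q; ψ) ≤ L² Σ_{r,r'} Re(f_r f̄_{r'}) C(r − r'; ψ)`

HONEST FRAMING: first certified bounds; not a superconductivity verdict; every number
certified or labelled float.  This file contains exact finite-torus IDENTITIES (Parseval over the
momentum index) and their immediate consequence, valid for EVERY vector `ψ` on every `L × L` torus —
kinematics, no bound on any Hubbard ground state is claimed here.

Companion of `Observables/StructureFactors{,Positivity,SumRules}.lean` (speedrun `mbsolver`, M3 team,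
seat sr-mbsolver-m3-4, D7 (iii) upper side).  The point: a certified window on a FEJÉR / BOCHNER
weighted combination of short-range two-point words is a certified UPPER bound on the structure factor
`S(q; ψ)` — hence on the order parameter `m_q² = S(q)/N_s` — at ANY momentum `q`, including the stripe
wavevectors `Q_c = (π/4, 0)`, `Q_s = (7π/8, π)`; a Dirichlet-truncated cosine sum is not.
The tap transform `f̂(k) = Σ_r f(r) e^{iq·r}` is written out as `∑ r, f r * blochPhase L k r`.

* `sum_normSq_tap_mul` (Parseval kernel): if `F(k) = Σ_d e^{-iq·d} E(d)` for all `k` then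
  `Σ_k |f̂(k)|² F(k) = L² Σ_{r,r'} f(r) f̄(r') E(r − r')`;
* `sum_normSq_tap_mul_spinStructureFactor` (+ density twin):
  **`Σ_k |f̂(k)|² S_s(k; ψ) = Re ⟨ψ, Σ_{r,r'} f(r) f̄(r') W_{r−r'} ψ⟩`**;
* `normSq_tap_mul_spinStructureFactor_le` (+ density twin, per-site forms `…_le_sum_spinCorr`):
  **`|f̂(q)|² S_s(q; ψ) ≤ Re ⟨ψ, Σ_{r,r'} f(r) f̄(r') W_{r−r'} ψ⟩ = L² Σ Re(f f̄') C_s(r − r'; ψ)`**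
  (drop the other momenta: each `S_s(k; ψ) ≥ 0`, `spinStructureFactor_nonneg`; `W_{-r} = W_r`
  symmetrises the weights); `spinStructureFactor_le_of_tap_eq_one`: normalisation `f̂(q) = 1`;
* `normSq_sum_mul_spinStructureFactor_le_window` (+ density twin): taps `c` on a finite window `A`,
  **`|Σ_{a∈A} c_a e^{iq·a}|² S_s(q; ψ) ≤ L² Σ_{a,a'∈A} Re(c_a c̄_{a'}) C_s(a − a'; ψ)`** — the form the
  M3 (iii) `LRO` rows use (`2 × 2` plaquette, staggered taps `±1/4`, for `Q_s`; taps `{1/2, (1−i)/3}`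
  on `{0, e₁}` for `Q_c`);
* `normSq_tap_mul_densityStructureFactor_add_le_of_isNParticle` (+ window form): on a unit `N`-particle
  vector and `q ≠ 0` the Bragg peak `|f̂(0)|² N²/L²` is split off: the CONNECTED table `C_c − n²` enters.

TL reading (words only, M3.md §2(iii); lead ruling r92: no TL instance is typed): for a translation-invariant
state on `ℤ²` the correlator table is positive-definite (Herglotz), and the same argument bounds the Bragg
weight `μ({Q}) = lim S(Q)/N_s` by `Σ Re(f f̄') C / |f̂(Q)|²`; a uniform `w × w` window gives the Fejér mean.
Refs: Hirsch, PRB 31 (1985) 4403, eq. (4.7); Katznelson, *An Introduction to Harmonic Analysis*, I.7.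
-/

noncomputable section

namespace Summit.Ventures.CertifiedManyBodySolver.Observables

open Matrix Literature.MathematicalPhysics.QuantumLattice Literature.Probability.LatticeModels
open Literature.MathematicalPhysics.QuantumLattice.HubbardWave0
open Literature.MathematicalPhysics.QuantumLattice.FermionTorus
open scoped BigOperators ComplexConjugate

section LROCeiling

variable (L : ℕ) [NeZero L]

/-- `e^{iq·(x-y)} = e^{iq·x} e^{-iq·y}`. -/
theorem blochPhase_sub (k x y : TorusSite 2 L) :
    blochPhase L k (x - y) = blochPhase L k x * star (blochPhase L k y) := by
  rw [sub_eq_add_neg, blochPhase_add, blochPhase_neg]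

/-- `e^{i0·x} = 1` (zero momentum). -/
theorem blochPhase_zero_left (x : TorusSite 2 L) : blochPhase L 0 x = 1 := by
  have h : torusDot L 0 x = 0 := by simp [torusDot]
  rw [blochPhase, h, AddChar.map_zero_eq_one]

/-- `f̂(k) \overline{f̂(k)} = |f̂(k)|²` as a real cast. -/
theorem sum_mul_blochPhase_mul_star (f : TorusSite 2 L → ℂ) (k : TorusSite 2 L) :
    (∑ r : TorusSite 2 L, f r * blochPhase L k r) * star ((∑ r : TorusSite 2 L, f r * blochPhase L k r)) = ((‖(∑ r : TorusSite 2 L, f r * blochPhase L k r)‖ ^ 2 : ℝ) : ℂ) := by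
  rw [Complex.star_def, Complex.mul_conj, Complex.normSq_eq_norm_sq, Complex.ofReal_pow]

/-- **Momentum kernel**: if `F(k) = Σ_d e^{-iq·d} E(d)` then
`Σ_k e^{iq·r} e^{-iq·r'} F(k) = L² · E(r − r')` (character orthogonality over momenta). -/
theorem sum_blochPhase_mul_star_mul (E F : TorusSite 2 L → ℂ)
    (hF : ∀ k, F k = ∑ d : TorusSite 2 L, star (blochPhase L k d) * E d) (r r' : TorusSite 2 L) :
    ∑ k : TorusSite 2 L, blochPhase L k r * star (blochPhase L k r') * F k =
      (L : ℂ) ^ 2 * E (r - r') := by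
  have h1 : ∀ k : TorusSite 2 L, blochPhase L k r * star (blochPhase L k r') * F k =
      ∑ d : TorusSite 2 L, blochPhase L k (r - r' - d) * E d := by
    intro k
    rw [hF k, Finset.mul_sum]
    refine Finset.sum_congr rfl fun d _ => ?_
    rw [blochPhase_sub, blochPhase_sub]
    ring
  simp_rw [h1]
  rw [Finset.sum_comm]
  simp_rw [← Finset.sum_mul, sum_blochPhase_momentum, sub_eq_zero, ite_mul, zero_mul]
  rw [Finset.sum_ite_eq]
  simp

/-- **Parseval kernel**: if `F(k) = Σ_d e^{-iq·d} E(d)` for every momentum `k`, then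
`Σ_k f̂(k) \overline{f̂(k)} F(k) = L² Σ_{r,r'} f(r) f̄(r') E(r − r')`. -/
theorem sum_normSq_tap_mul (f E F : TorusSite 2 L → ℂ)
    (hF : ∀ k, F k = ∑ d : TorusSite 2 L, star (blochPhase L k d) * E d) :
    ∑ k : TorusSite 2 L, (∑ r : TorusSite 2 L, f r * blochPhase L k r) * star ((∑ r : TorusSite 2 L, f r * blochPhase L k r)) * F k =
      (L : ℂ) ^ 2 * ∑ r : TorusSite 2 L, ∑ r' : TorusSite 2 L, f r * star (f r') * E (r - r') := by
  have hA : ∀ k : TorusSite 2 L, (∑ r : TorusSite 2 L, f r * blochPhase L k r) * star ((∑ r : TorusSite 2 L, f r * blochPhase L k r)) * F k =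
      ∑ r : TorusSite 2 L, ∑ r' : TorusSite 2 L,
        f r * star (f r') * (blochPhase L k r * star (blochPhase L k r') * F k) := by
    intro k
    rw [star_sum, Finset.sum_mul_sum, Finset.sum_mul]
    refine Finset.sum_congr rfl fun r _ => ?_
    rw [Finset.sum_mul]
    refine Finset.sum_congr rfl fun r' _ => ?_
    rw [star_mul']
    ring
  simp_rw [hA]
  calc ∑ k : TorusSite 2 L, ∑ r : TorusSite 2 L, ∑ r' : TorusSite 2 L,
          f r * star (f r') * (blochPhase L k r * star (blochPhase L k r') * F k)
      = ∑ r : TorusSite 2 L, ∑ k : TorusSite 2 L, ∑ r' : TorusSite 2 L,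
          f r * star (f r') * (blochPhase L k r * star (blochPhase L k r') * F k) := Finset.sum_comm
    _ = ∑ r : TorusSite 2 L, ∑ r' : TorusSite 2 L, ∑ k : TorusSite 2 L,
          f r * star (f r') * (blochPhase L k r * star (blochPhase L k r') * F k) :=
        Finset.sum_congr rfl fun r _ => Finset.sum_comm
    _ = ∑ r : TorusSite 2 L, ∑ r' : TorusSite 2 L, f r * star (f r') * ((L : ℂ) ^ 2 * E (r - r')) := by
        refine Finset.sum_congr rfl fun r _ => Finset.sum_congr rfl fun r' _ => ?_
        rw [← Finset.mul_sum, sum_blochPhase_mul_star_mul L E F hF]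
    _ = (L : ℂ) ^ 2 * ∑ r : TorusSite 2 L, ∑ r' : TorusSite 2 L, f r * star (f r') * E (r - r') := by
        rw [Finset.mul_sum]
        refine Finset.sum_congr rfl fun r _ => ?_
        rw [Finset.mul_sum]
        refine Finset.sum_congr rfl fun r' _ => ?_
        ring

/-- `Re(L² z) / L² = Re z`. -/
private theorem re_sq_mul_div_sq' (z : ℂ) :
    (((L : ℂ) ^ 2) * z).re / (L : ℝ) ^ 2 = z.re := by
  have hL : (L : ℝ) ≠ 0 := Nat.cast_ne_zero.mpr (NeZero.ne L)
  have h1 : (((L : ℂ) ^ 2) * z).re = (L : ℝ) ^ 2 * z.re := by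
    have : ((L : ℂ) ^ 2) = (((L : ℝ) ^ 2 : ℝ) : ℂ) := by push_cast; rfl
    rw [this, Complex.re_ofReal_mul]
  rw [h1]
  field_simp

/-- Generic step: from the Parseval kernel to `Σ_k |f̂(k)|² · (Re F(k) / L²) = Re Σ_{r,r'} f f̄' E`. -/
private theorem sum_normSq_mul_re_div_eq (f E F : TorusSite 2 L → ℂ)
    (hF : ∀ k, F k = ∑ d : TorusSite 2 L, star (blochPhase L k d) * E d) :
    ∑ k : TorusSite 2 L, ‖(∑ r : TorusSite 2 L, f r * blochPhase L k r)‖ ^ 2 * ((F k).re / (L : ℝ) ^ 2) =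
      (∑ r : TorusSite 2 L, ∑ r' : TorusSite 2 L, f r * star (f r') * E (r - r')).re := by
  have h := sum_normSq_tap_mul L f E F hF
  simp_rw [sum_mul_blochPhase_mul_star] at h
  have h2 : ∀ k : TorusSite 2 L, ‖(∑ r : TorusSite 2 L, f r * blochPhase L k r)‖ ^ 2 * ((F k).re / (L : ℝ) ^ 2) =
      ((((‖(∑ r : TorusSite 2 L, f r * blochPhase L k r)‖ ^ 2 : ℝ) : ℂ)) * F k).re / (L : ℝ) ^ 2 := by
    intro k
    rw [Complex.re_ofReal_mul]
    ring
  simp_rw [h2]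
  rw [← Finset.sum_div, ← Complex.re_sum, h]
  exact re_sq_mul_div_sq' L _

/-- **`Σ_k |f̂(k)|² S_s(k; ψ) = Re ⟨ψ, Σ_{r,r'} f(r) f̄(r') W_{r−r'} ψ⟩`** (finite-torus Parseval /
Wiener–Khinchin for the spin channel). -/
theorem sum_normSq_tap_mul_spinStructureFactor (f : TorusSite 2 L → ℂ)
    (ψ : Fock (Orb (FermionTorus 2 L))) :
    ∑ k : TorusSite 2 L, ‖(∑ r : TorusSite 2 L, f r * blochPhase L k r)‖ ^ 2 * spinStructureFactor L k ψ =
      (∑ r : TorusSite 2 L, ∑ r' : TorusSite 2 L,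
        f r * star (f r') * expect (spinCorrSum L (r - r')) ψ).re := by
  have hF : ∀ k : TorusSite 2 L, expect (spinStructureOp L k) ψ =
      ∑ d : TorusSite 2 L, star (blochPhase L k d) * expect (spinCorrSum L d) ψ := by
    intro k
    rw [spinStructureOp_eq_sum_smul_spinCorrSum, expect_sum]
    exact Finset.sum_congr rfl fun d _ => expect_smul _ _ _
  exact sum_normSq_mul_re_div_eq L f (fun d => expect (spinCorrSum L d) ψ)
    (fun k => expect (spinStructureOp L k) ψ) hF

/-- **`Σ_k |f̂(k)|² S_c(k; ψ) = Re ⟨ψ, Σ_{r,r'} f(r) f̄(r') N_{r−r'} ψ⟩`** (density channel). -/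
theorem sum_normSq_tap_mul_densityStructureFactor (f : TorusSite 2 L → ℂ)
    (ψ : Fock (Orb (FermionTorus 2 L))) :
    ∑ k : TorusSite 2 L, ‖(∑ r : TorusSite 2 L, f r * blochPhase L k r)‖ ^ 2 * densityStructureFactor L k ψ =
      (∑ r : TorusSite 2 L, ∑ r' : TorusSite 2 L,
        f r * star (f r') * expect (densityCorrSum L (r - r')) ψ).re := by
  have hF : ∀ k : TorusSite 2 L, expect (densityStructureOp L k) ψ =
      ∑ d : TorusSite 2 L, star (blochPhase L k d) * expect (densityCorrSum L d) ψ := by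
    intro k
    rw [densityStructureOp_eq_sum_smul_densityCorrSum, expect_sum]
    exact Finset.sum_congr rfl fun d _ => expect_smul _ _ _
  exact sum_normSq_mul_re_div_eq L f (fun d => expect (densityCorrSum L d) ψ)
    (fun k => expect (densityStructureOp L k) ψ) hF

/-- **LRO ceiling, spin channel: `|f̂(q)|² · S_s(q; ψ) ≤ Re ⟨ψ, Σ_{r,r'} f(r) f̄(r') W_{r−r'} ψ⟩`**
for every tap function `f`, every momentum `q` and every vector `ψ`. -/
theorem normSq_tap_mul_spinStructureFactor_le (f : TorusSite 2 L → ℂ) (k : TorusSite 2 L)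
    (ψ : Fock (Orb (FermionTorus 2 L))) :
    ‖(∑ r : TorusSite 2 L, f r * blochPhase L k r)‖ ^ 2 * spinStructureFactor L k ψ ≤
      (∑ r : TorusSite 2 L, ∑ r' : TorusSite 2 L,
        f r * star (f r') * expect (spinCorrSum L (r - r')) ψ).re := by
  rw [← sum_normSq_tap_mul_spinStructureFactor]
  exact Finset.single_le_sum (f := fun k => ‖(∑ r : TorusSite 2 L, f r * blochPhase L k r)‖ ^ 2 * spinStructureFactor L k ψ)
    (fun k _ => mul_nonneg (sq_nonneg _) (spinStructureFactor_nonneg L k ψ)) (Finset.mem_univ k)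

/-- **LRO ceiling, density channel: `|f̂(q)|² · S_c(q; ψ) ≤ Re ⟨ψ, Σ_{r,r'} f(r) f̄(r') N_{r−r'} ψ⟩`.** -/
theorem normSq_tap_mul_densityStructureFactor_le (f : TorusSite 2 L → ℂ) (k : TorusSite 2 L)
    (ψ : Fock (Orb (FermionTorus 2 L))) :
    ‖(∑ r : TorusSite 2 L, f r * blochPhase L k r)‖ ^ 2 * densityStructureFactor L k ψ ≤
      (∑ r : TorusSite 2 L, ∑ r' : TorusSite 2 L,
        f r * star (f r') * expect (densityCorrSum L (r - r')) ψ).re := by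
  rw [← sum_normSq_tap_mul_densityStructureFactor]
  exact Finset.single_le_sum (f := fun k => ‖(∑ r : TorusSite 2 L, f r * blochPhase L k r)‖ ^ 2 * densityStructureFactor L k ψ)
    (fun k _ => mul_nonneg (sq_nonneg _) (densityStructureFactor_nonneg L k ψ)) (Finset.mem_univ k)

/-- With the normalisation **`f̂(q) = 1`**: `S_s(q; ψ) ≤ Re ⟨ψ, Σ_{r,r'} f(r) f̄(r') W_{r−r'} ψ⟩`. -/
theorem spinStructureFactor_le_of_tap_eq_one (f : TorusSite 2 L → ℂ) (k : TorusSite 2 L)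
    (hf : (∑ r : TorusSite 2 L, f r * blochPhase L k r) = 1) (ψ : Fock (Orb (FermionTorus 2 L))) :
    spinStructureFactor L k ψ ≤
      (∑ r : TorusSite 2 L, ∑ r' : TorusSite 2 L,
        f r * star (f r') * expect (spinCorrSum L (r - r')) ψ).re := by
  have h := normSq_tap_mul_spinStructureFactor_le L f k ψ
  rwa [hf, norm_one, one_pow, one_mul] at h

/-- With **`f̂(q) = 1`**: `S_c(q; ψ) ≤ Re ⟨ψ, Σ_{r,r'} f(r) f̄(r') N_{r−r'} ψ⟩`. -/
theorem densityStructureFactor_le_of_tap_eq_one (f : TorusSite 2 L → ℂ) (k : TorusSite 2 L)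
    (hf : (∑ r : TorusSite 2 L, f r * blochPhase L k r) = 1) (ψ : Fock (Orb (FermionTorus 2 L))) :
    densityStructureFactor L k ψ ≤
      (∑ r : TorusSite 2 L, ∑ r' : TorusSite 2 L,
        f r * star (f r') * expect (densityCorrSum L (r - r')) ψ).re := by
  have h := normSq_tap_mul_densityStructureFactor_le L f k ψ
  rwa [hf, norm_one, one_pow, one_mul] at h

/-- **LRO ceiling, density channel, connected form on the `N`-particle sector**: for `q ≠ 0` and a
unit `N`-particle vector, the Bragg peak `S_c(0; ψ) = N²/L²` (`densityStructureFactor_zero_of_isNParticle`)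
may be split off as well:
`|f̂(q)|² S_c(q; ψ) + |f̂(0)|² N²/L² ≤ Re ⟨ψ, Σ_{r,r'} f(r) f̄(r') N_{r−r'} ψ⟩` — i.e. the ceiling on
`S_c(q ≠ 0)` uses the CONNECTED functional `Σ Re(f f̄') (C_c(r−r') − n²)`, `n = N/L²`. -/
theorem normSq_tap_mul_densityStructureFactor_add_le_of_isNParticle {N : ℕ}
    {ψ : Fock (Orb (FermionTorus 2 L))} (hψ : IsNParticle N ψ) (hnorm : star ψ ⬝ᵥ ψ = 1)
    (f : TorusSite 2 L → ℂ) {k : TorusSite 2 L} (hk : k ≠ 0) :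
    ‖(∑ r : TorusSite 2 L, f r * blochPhase L k r)‖ ^ 2 * densityStructureFactor L k ψ +
        ‖(∑ r : TorusSite 2 L, f r * blochPhase L 0 r)‖ ^ 2 * ((N : ℝ) ^ 2 / (L : ℝ) ^ 2) ≤
      (∑ r : TorusSite 2 L, ∑ r' : TorusSite 2 L,
        f r * star (f r') * expect (densityCorrSum L (r - r')) ψ).re := by
  have h0 : densityStructureFactor L 0 ψ = (N : ℝ) ^ 2 / (L : ℝ) ^ 2 := by
    rw [densityStructureFactor_zero_of_isNParticle L hψ, hnorm]
    simp
  rw [← sum_normSq_tap_mul_densityStructureFactor, ← h0,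
    ← Finset.sum_pair (f := fun k => ‖(∑ r : TorusSite 2 L, f r * blochPhase L k r)‖ ^ 2 *
      densityStructureFactor L k ψ) hk]
  exact Finset.sum_le_sum_of_subset_of_nonneg (Finset.subset_univ _)
    (fun k _ _ => mul_nonneg (sq_nonneg _) (densityStructureFactor_nonneg L k ψ))

/-! ### Per-site form: symmetrised real weights against the correlator tables `C_s`, `C_c` -/

/-- Symmetrisation: if `w(−d) = w(d)` then `Σ_{r,r'} f(r) f̄(r') w(r − r') = Σ_{r,r'} Re(f(r) f̄(r')) w(r − r')`
(pair `(r, r')` with `(r', r)`). -/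
theorem sum_sum_mul_star_mul_eq_re (f w : TorusSite 2 L → ℂ) (hw : ∀ d, w (-d) = w d) :
    ∑ r : TorusSite 2 L, ∑ r' : TorusSite 2 L, f r * star (f r') * w (r - r') =
      ∑ r : TorusSite 2 L, ∑ r' : TorusSite 2 L, (((f r * star (f r')).re : ℝ) : ℂ) * w (r - r') := by
  have hswap : ∑ r : TorusSite 2 L, ∑ r' : TorusSite 2 L, f r * star (f r') * w (r - r') =
      ∑ r : TorusSite 2 L, ∑ r' : TorusSite 2 L, star (f r * star (f r')) * w (r - r') := by
    rw [Finset.sum_comm]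
    refine Finset.sum_congr rfl fun r _ => Finset.sum_congr rfl fun r' _ => ?_
    rw [star_mul', star_star, ← neg_sub r r', hw]
    ring
  have h2 : ∑ r : TorusSite 2 L, ∑ r' : TorusSite 2 L, f r * star (f r') * w (r - r') +
      ∑ r : TorusSite 2 L, ∑ r' : TorusSite 2 L, star (f r * star (f r')) * w (r - r') =
      (2 : ℂ) * ∑ r : TorusSite 2 L, ∑ r' : TorusSite 2 L,
        (((f r * star (f r')).re : ℝ) : ℂ) * w (r - r') := by
    rw [← Finset.sum_add_distrib, Finset.mul_sum]
    refine Finset.sum_congr rfl fun r _ => ?_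
    rw [← Finset.sum_add_distrib, Finset.mul_sum]
    refine Finset.sum_congr rfl fun r' _ => ?_
    rw [← add_mul, Complex.star_def, Complex.add_conj]
    push_cast
    ring
  have h3 : (2 : ℂ) * ∑ r : TorusSite 2 L, ∑ r' : TorusSite 2 L, f r * star (f r') * w (r - r') =
      (2 : ℂ) * ∑ r : TorusSite 2 L, ∑ r' : TorusSite 2 L,
        (((f r * star (f r')).re : ℝ) : ℂ) * w (r - r') := by
    rw [two_mul]
    nth_rewrite 2 [hswap]
    exact h2
  exact mul_left_cancel₀ two_ne_zero h3

/-- `Re (Σ_{r,r'} Re(c_{rr'}) · ⟨ψ, B_{r−r'} ψ⟩) = L² Σ_{r,r'} Re(c_{rr'}) · (Re⟨ψ, B_{r−r'} ψ⟩ / L²)`. -/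
private theorem re_sum_sum_ofReal_mul (c : TorusSite 2 L → TorusSite 2 L → ℝ) (w : TorusSite 2 L → ℂ) :
    (∑ r : TorusSite 2 L, ∑ r' : TorusSite 2 L, ((c r r' : ℝ) : ℂ) * w (r - r')).re =
      (L : ℝ) ^ 2 * ∑ r : TorusSite 2 L, ∑ r' : TorusSite 2 L, c r r' * ((w (r - r')).re / (L : ℝ) ^ 2) := by
  have hL : (L : ℝ) ≠ 0 := Nat.cast_ne_zero.mpr (NeZero.ne L)
  rw [Complex.re_sum, Finset.mul_sum]
  refine Finset.sum_congr rfl fun r _ => ?_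
  rw [Complex.re_sum, Finset.mul_sum]
  refine Finset.sum_congr rfl fun r' _ => ?_
  rw [Complex.re_ofReal_mul]
  field_simp

/-- **LRO ceiling, spin channel, per-site form:
`|f̂(q)|² · S_s(q; ψ) ≤ L² · Σ_{r,r'} Re(f(r) f̄(r')) · C_s(r − r'; ψ)`** — the right-hand side is a
real linear functional of the per-displacement spin-correlator table (certifiable word by word or,
better, as ONE SDP objective). Dividing by `L²`: the order parameter `m_q²(ψ) := S_s(q; ψ)/L²` obeys
`|f̂(q)|² m_q² ≤ Σ_{r,r'} Re(f(r) f̄(r')) C_s(r − r'; ψ)`. -/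
theorem normSq_tap_mul_spinStructureFactor_le_sum_spinCorr (f : TorusSite 2 L → ℂ)
    (k : TorusSite 2 L) (ψ : Fock (Orb (FermionTorus 2 L))) :
    ‖(∑ r : TorusSite 2 L, f r * blochPhase L k r)‖ ^ 2 * spinStructureFactor L k ψ ≤
      (L : ℝ) ^ 2 * ∑ r : TorusSite 2 L, ∑ r' : TorusSite 2 L,
        (f r * star (f r')).re * spinCorr L (r - r') ψ := by
  have h := normSq_tap_mul_spinStructureFactor_le L f k ψ
  rw [sum_sum_mul_star_mul_eq_re L f (fun d => expect (spinCorrSum L d) ψ)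
      (fun d => by simp only [spinCorrSum_neg])] at h
  have h3 : (∑ r : TorusSite 2 L, ∑ r' : TorusSite 2 L,
      (((f r * star (f r')).re : ℝ) : ℂ) * expect (spinCorrSum L (r - r')) ψ).re =
      (L : ℝ) ^ 2 * ∑ r : TorusSite 2 L, ∑ r' : TorusSite 2 L,
        (f r * star (f r')).re * spinCorr L (r - r') ψ :=
    re_sum_sum_ofReal_mul L (fun r r' => (f r * star (f r')).re) (fun d => expect (spinCorrSum L d) ψ)
  exact h.trans_eq h3

/-- **LRO ceiling, density channel, per-site form:
`|f̂(q)|² · S_c(q; ψ) ≤ L² · Σ_{r,r'} Re(f(r) f̄(r')) · C_c(r − r'; ψ)`.** -/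
theorem normSq_tap_mul_densityStructureFactor_le_sum_densityCorr (f : TorusSite 2 L → ℂ)
    (k : TorusSite 2 L) (ψ : Fock (Orb (FermionTorus 2 L))) :
    ‖(∑ r : TorusSite 2 L, f r * blochPhase L k r)‖ ^ 2 * densityStructureFactor L k ψ ≤
      (L : ℝ) ^ 2 * ∑ r : TorusSite 2 L, ∑ r' : TorusSite 2 L,
        (f r * star (f r')).re * densityCorr L (r - r') ψ := by
  have h := normSq_tap_mul_densityStructureFactor_le L f k ψ
  rw [sum_sum_mul_star_mul_eq_re L f (fun d => expect (densityCorrSum L d) ψ)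
      (fun d => by simp only [densityCorrSum_neg])] at h
  have h3 : (∑ r : TorusSite 2 L, ∑ r' : TorusSite 2 L,
      (((f r * star (f r')).re : ℝ) : ℂ) * expect (densityCorrSum L (r - r')) ψ).re =
      (L : ℝ) ^ 2 * ∑ r : TorusSite 2 L, ∑ r' : TorusSite 2 L,
        (f r * star (f r')).re * densityCorr L (r - r') ψ :=
    re_sum_sum_ofReal_mul L (fun r r' => (f r * star (f r')).re) (fun d => expect (densityCorrSum L d) ψ)
  exact h.trans_eq h3

/-! ### Window form: taps supported on a finite set `A` (the `w × w` windows of the M3 rows) -/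

/-- The tap transform of a window-supported tap function. -/
theorem sum_indicator_mul_blochPhase (A : Finset (TorusSite 2 L)) (c : TorusSite 2 L → ℂ) (k : TorusSite 2 L) :
    (∑ r : TorusSite 2 L, (fun r => if r ∈ A then c r else 0) r * blochPhase L k r) =
      ∑ a ∈ A, c a * blochPhase L k a := by
  simp_rw [ite_mul, zero_mul]
  rw [Finset.sum_ite_mem, Finset.univ_inter]

/-- Window reduction of the double sum. -/
private theorem sum_sum_indicator_re_mul (A : Finset (TorusSite 2 L)) (c : TorusSite 2 L → ℂ)
    (C : TorusSite 2 L → ℝ) :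
    ∑ r : TorusSite 2 L, ∑ r' : TorusSite 2 L,
        ((fun r => if r ∈ A then c r else 0) r * star ((fun r => if r ∈ A then c r else 0) r')).re *
          C (r - r') =
      ∑ a ∈ A, ∑ a' ∈ A, (c a * star (c a')).re * C (a - a') := by
  have h : ∀ r r' : TorusSite 2 L,
      ((fun r => if r ∈ A then c r else 0) r * star ((fun r => if r ∈ A then c r else 0) r')).re *
          C (r - r') =
        if r ∈ A then (if r' ∈ A then (c r * star (c r')).re * C (r - r') else 0) else 0 := by
    intro r r'
    by_cases hr : r ∈ A <;> by_cases hr' : r' ∈ A <;> simp [hr, hr']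
  simp_rw [h]
  have inner : ∀ r : TorusSite 2 L,
      (∑ r' : TorusSite 2 L,
          if r ∈ A then (if r' ∈ A then (c r * star (c r')).re * C (r - r') else 0) else 0) =
        if r ∈ A then ∑ r' ∈ A, (c r * star (c r')).re * C (r - r') else 0 := by
    intro r
    split_ifs with hr
    · rw [Finset.sum_ite_mem, Finset.univ_inter]
    · simp
  simp_rw [inner]
  rw [Finset.sum_ite_mem, Finset.univ_inter]

/-- **LRO ceiling, spin channel, window form**: for taps `c` on a finite window `A`,
`|Σ_{a ∈ A} c_a e^{iq·a}|² · S_s(q; ψ) ≤ L² · Σ_{a,a' ∈ A} Re(c_a c̄_{a'}) · C_s(a − a'; ψ)` — only the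
correlators at displacements `a − a'`, `a, a' ∈ A` (diameter of the window) enter. -/
theorem normSq_sum_mul_spinStructureFactor_le_window (A : Finset (TorusSite 2 L))
    (c : TorusSite 2 L → ℂ) (k : TorusSite 2 L) (ψ : Fock (Orb (FermionTorus 2 L))) :
    ‖∑ a ∈ A, c a * blochPhase L k a‖ ^ 2 * spinStructureFactor L k ψ ≤
      (L : ℝ) ^ 2 * ∑ a ∈ A, ∑ a' ∈ A, (c a * star (c a')).re * spinCorr L (a - a') ψ := by
  have h := normSq_tap_mul_spinStructureFactor_le_sum_spinCorr L
    (fun r => if r ∈ A then c r else 0) k ψ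
  rwa [sum_indicator_mul_blochPhase, sum_sum_indicator_re_mul L A c (fun d => spinCorr L d ψ)] at h

/-- **LRO ceiling, density channel, window form**:
`|Σ_{a ∈ A} c_a e^{iq·a}|² · S_c(q; ψ) ≤ L² · Σ_{a,a' ∈ A} Re(c_a c̄_{a'}) · C_c(a − a'; ψ)`. -/
theorem normSq_sum_mul_densityStructureFactor_le_window (A : Finset (TorusSite 2 L))
    (c : TorusSite 2 L → ℂ) (k : TorusSite 2 L) (ψ : Fock (Orb (FermionTorus 2 L))) :
    ‖∑ a ∈ A, c a * blochPhase L k a‖ ^ 2 * densityStructureFactor L k ψ ≤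
      (L : ℝ) ^ 2 * ∑ a ∈ A, ∑ a' ∈ A, (c a * star (c a')).re * densityCorr L (a - a') ψ := by
  have h := normSq_tap_mul_densityStructureFactor_le_sum_densityCorr L
    (fun r => if r ∈ A then c r else 0) k ψ
  rwa [sum_indicator_mul_blochPhase, sum_sum_indicator_re_mul L A c (fun d => densityCorr L d ψ)] at h

/-- **LRO ceiling, density channel, connected window form on the `N`-particle sector** (`q ≠ 0`):
`|Σ_{a∈A} c_a e^{iq·a}|² S_c(q; ψ) + |Σ_{a∈A} c_a|² N²/L² ≤ L² Σ_{a,a'∈A} Re(c_a c̄_{a'}) C_c(a − a'; ψ)`;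
equivalently, with `n = N/L²`, `|ĉ(q)|² S_c(q; ψ)/L² ≤ Σ_{a,a'} Re(c_a c̄_{a'}) (C_c(a − a'; ψ) − n²)`. -/
theorem normSq_sum_mul_densityStructureFactor_add_le_window_of_isNParticle {N : ℕ}
    {ψ : Fock (Orb (FermionTorus 2 L))} (hψ : IsNParticle N ψ) (hnorm : star ψ ⬝ᵥ ψ = 1)
    (A : Finset (TorusSite 2 L)) (c : TorusSite 2 L → ℂ) {k : TorusSite 2 L} (hk : k ≠ 0) :
    ‖∑ a ∈ A, c a * blochPhase L k a‖ ^ 2 * densityStructureFactor L k ψ +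
        ‖∑ a ∈ A, c a‖ ^ 2 * ((N : ℝ) ^ 2 / (L : ℝ) ^ 2) ≤
      (L : ℝ) ^ 2 * ∑ a ∈ A, ∑ a' ∈ A, (c a * star (c a')).re * densityCorr L (a - a') ψ := by
  have h := normSq_tap_mul_densityStructureFactor_add_le_of_isNParticle L hψ hnorm
    (fun r => if r ∈ A then c r else 0) hk
  rw [sum_sum_mul_star_mul_eq_re L _ (fun d => expect (densityCorrSum L d) ψ)
      (fun d => by simp only [densityCorrSum_neg])] at h
  have h3 : (∑ r : TorusSite 2 L, ∑ r' : TorusSite 2 L,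
      ((((fun r => if r ∈ A then c r else 0) r * star ((fun r => if r ∈ A then c r else 0) r')).re
        : ℝ) : ℂ) * expect (densityCorrSum L (r - r')) ψ).re =
      (L : ℝ) ^ 2 * ∑ r : TorusSite 2 L, ∑ r' : TorusSite 2 L,
        ((fun r => if r ∈ A then c r else 0) r * star ((fun r => if r ∈ A then c r else 0) r')).re *
          densityCorr L (r - r') ψ :=
    re_sum_sum_ofReal_mul L _ (fun d => expect (densityCorrSum L d) ψ)
  rw [sum_indicator_mul_blochPhase, sum_indicator_mul_blochPhase] at h
  simp_rw [blochPhase_zero_left, mul_one] at h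
  rw [sum_sum_indicator_re_mul L A c (fun d => densityCorr L d ψ)] at h3
  exact h.trans_eq h3

end LROCeiling

end Summit.Ventures.CertifiedManyBodySolver.Observables
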